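import Mathlib
import Literature.Computability.AlgebraicComplexity.EquivariantDC
import Literature.Computability.AlgebraicComplexity.DetReprEquivalent
import Literature.Computability.AlgebraicComplexity.LRPencilOfMatrix
import Literature.Computability.AlgebraicComplexity.LandsbergRessayreNormalForm
import Literature.Computability.AlgebraicComplexity.LRLiftCharacter
import Literature.Computability.AlgebraicComplexity.LR21Datum
import Literature.Computability.AlgebraicComplexity.VonZurGathenSingPermHeight
import Literature.Computability.AlgebraicComplexity.ApolarityFischerPairing
import HarnessLib

/-!
# Route FreeSubtorus — crux `OrbitDimensionBound` (stmt-ValiantsHypothesis-16133), line `quadratic_covering`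
# (a RUNG line: target `Degree.QuadraticShadow`; the crux stays OPEN), registered stub 1 `stub_gradedLift`

`stub_gradedLift` below is the registered statement `Stmt.stub_gradedLift` of
`Cruxes/OrbitDimensionBound/Lines/quadratic_covering.lean` with the line-local `IsDegEquivariantDetRepr`
(`Lines/DegreeLadder.lean`) and `torusGen` UNFOLDED verbatim (Cruxes files are not importable from `Theorems/`);
the skeleton closes its `sorry` by `exact …Theorems.FreeSubtorusOrbitDimensionBound.stub_gradedLift` (scratch-checked
rc 0 against verbatim copies).  With it the line `quadratic_covering` rests on `stub_windowWeights` (L) and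
`stub_windowCount` (M).  Merged desk RULING #100, CLAIM-FIRST #8 of val-lit-p7 g10 (2026-08-28),
`--supports stmt-ValiantsHypothesis-16133 --as helper`.

Honest framing: a registered stub (size M, bookkeeping + von zur Gathen regularity by name) of a RUNG line inside one
route; the rung `QuadraticShadow`, the crux `OrbitDimensionBound` (stmt-16133) and route FreeSubtorus stay OPEN;
census-neutral; nothing here bears on `VP ≠ VNP` (NOT proved).  No definitions, no named facts.
-/

set_option linter.dupNamespace false
set_option autoImplicit false

noncomputable section

open Matrix MvPolynomial Finset
open Literature.Computability.AlgebraicComplexity LRPencil VonZurGathen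

namespace Summit.ValiantsHypothesis.ValiantsHypothesis.Theorems.FreeSubtorusOrbitDimensionBound

namespace GradedLift

/-- Coefficient matrices commute with constant conjugation: `(g·B·h)_u = g · B_u · h` for every monomial `u`.
[folklore] -/
theorem map_coeff_C_mul_mul_C {σ : Type*} {ι : Type*} [Fintype ι] (g : Matrix ι ι ℂ)
    (B : Matrix ι ι (MvPolynomial σ ℂ)) (h : Matrix ι ι ℂ) (u : σ →₀ ℕ) :
    ((g.map (C : ℂ →+* MvPolynomial σ ℂ)) * B * h.map (C : ℂ →+* MvPolynomial σ ℂ)).map (coeff u) =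
      g * B.map (coeff u) * h := by
  ext r c
  simp only [Matrix.map_apply, Matrix.mul_apply, coeff_sum, coeff_mul_C', coeff_C_mul, Finset.sum_mul]

/-- A diagonal substitution `x_p ↦ c_p x_p` scales the `u`-th coefficient matrix by `c^u = ∏_p c_p^{u_p}`.
[folklore] -/
theorem map_coeff_linSubstEntries_diagonal {σ : Type*} [Fintype σ] [DecidableEq σ] {ι : Type*}
    (γ : GL σ ℂ) (c : σ → ℂ) (hγ : (γ : Matrix σ σ ℂ) = Matrix.diagonal c)
    (B : Matrix ι ι (MvPolynomial σ ℂ)) (u : σ →₀ ℕ) :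
    (Literature.Computability.AlgebraicComplexity.Matrix.linSubstEntries γ B).map (coeff u) =
      (∏ p, c p ^ (u p)) • B.map (coeff u) := by
  ext i j
  simp only [Matrix.map_apply, Matrix.smul_apply, smul_eq_mul, Matrix.linSubstEntries_apply, hγ,
    coeff_linSubst_diagonal]
  congr 1
  exact Finset.prod_subset (Finset.subset_univ _) fun p _ hp => by
    rw [Finsupp.notMem_support_iff.1 hp, pow_zero]

/-- **Regularity for entries of any degree** (von zur Gathen 1987, Thm. 3.1, the tree's
`vonzurGathen1987_perm_detRepr_rank_holds`): a determinantal representation of `perm_n` (`n ≥ 3`) by a matrix of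
polynomials of size `m` has constant part of rank exactly `m - 1`. [cite: Vonzurgathen1987, Thm. 3.1] -/
theorem rank_constPart_eq {n m : ℕ} (hn : 3 ≤ n) {B : Matrix (Fin m) (Fin m) (MvPolynomial (Fin n × Fin n) ℂ)}
    (hdet : B.det = perPoly (Fin n) ℂ) : (constPart B).rank = m - 1 := by
  have hge : m ≤ (constPart B).rank + 1 := by
    rw [constPart_eq_map_eval_zero]
    exact vonzurGathen1987_perm_detRepr_rank_holds ℂ two_ne_zero n hn m B hdet 0
  have hdet0 : (constPart B).det = 0 := by
    rw [det_constPart, hdet, constantCoeff_perPoly ℂ (by omega)]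
  have hlt := Matrix.rank_lt_card_of_det_eq_zero hdet0
  rw [Fintype.card_fin] at hlt
  omega

end GradedLift

open GradedLift

/-- **Registered stub 1 of the line `quadratic_covering` — `Stmt.stub_gradedLift`** (the line-local
`IsDegEquivariantDetRepr` (DegreeLadder) and `torusGen` UNFOLDED verbatim; `constPart`, `Matrix.linSubstEntries`,
`perPoly` are the Literature notions the line uses; the skeleton `Cruxes/OrbitDimensionBound/Lines/quadratic_covering.lean`
closes its `sorry` by `exact` — scratch-checked against verbatim copies).  GRADED LIFT PACKAGE for a degree-`δ`
`T_Λ`-equivariant representation `B` of `perm_n` and `(d, e)` satisfying the relations of `Λ`: the exact lift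
`(g, h)` of the diagonal torus element `x_{kl} ↦ d_k e_l x_{kl}` acts MONOMIAL-WISE, `g · B_u = (de)^u · B_u · h` for
every exponent `u` (`coeff_linSubst_diagonal`); the constant part is regular, `rank B₀ = m - 1` (von zur Gathen, the
tree's `vonzurGathen1987_perm_detRepr_rank_holds`, valid for entries of any degree); and the kernel LINE of `B₀` is
`h`-stable, hence carries an eigenvalue `γ₀ ≠ 0` of `h` (`finrank_ker_toLin'_eq_one`,
`exists_eigenvalue_of_finrank_ker_eq_one`).  Merged desk RULING #100 preference, CLAIM-FIRST #8 of val-lit-p7 g10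
(2026-08-28), `--supports stmt-ValiantsHypothesis-16133 --as helper`.

Honest framing: a registered stub (size M, bookkeeping) of a RUNG line inside one route; the line's load-bearing
`stub_windowWeights` and `stub_windowCount`, the rung `QuadraticShadow`, the crux `OrbitDimensionBound` (stmt-16133) and
route FreeSubtorus stay OPEN; census-neutral; nothing here bears on `VP ≠ VNP` (NOT proved).  No definitions, no named
facts. [cite: LandsbergRessayre2017, §6] [cite: Vonzurgathen1987, Thm. 3.1] -/
theorem stub_gradedLift :
    ∀ (δ n : ℕ), 3 ≤ n → ∀ (m r : ℕ) (Λ : Fin r → (Fin n ⊕ Fin n) → ℤ)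
      (B : Matrix (Fin m) (Fin m) (MvPolynomial (Fin n × Fin n) ℂ)),
      (((∀ i j, (B i j).totalDegree ≤ δ) ∧ B.det = perPoly (Fin n) ℂ) ∧
        ∀ γ ∈ Subgroup.closure {γ : Matrix.GeneralLinearGroup (Fin n × Fin n) ℂ |
            ∃ d e : Fin n → ℂˣ, (∀ i, (∏ k, (d k) ^ (Λ i (Sum.inl k))) * (∏ l, (e l) ^ (Λ i (Sum.inr l))) = 1) ∧
              (γ : Matrix (Fin n × Fin n) (Fin n × Fin n) ℂ) =
                Matrix.diagonal (fun p => (d p.1 : ℂ) * (e p.2 : ℂ))},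
          ∃ g h : GL (Fin m) ℂ,
            Literature.Computability.AlgebraicComplexity.Matrix.linSubstEntries γ B =
              (g : Matrix (Fin m) (Fin m) ℂ).map C * B * ((h⁻¹ : GL (Fin m) ℂ) : Matrix (Fin m) (Fin m) ℂ).map C) →
      ∀ d e : Fin n → ℂˣ, (∀ i, (∏ k, (d k) ^ (Λ i (Sum.inl k))) * (∏ l, (e l) ^ (Λ i (Sum.inr l))) = 1) →
      ∃ (g h : GL (Fin m) ℂ) (γ₀ : ℂ), γ₀ ≠ 0 ∧
        (∀ u : (Fin n × Fin n) →₀ ℕ,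
          (g : Matrix (Fin m) (Fin m) ℂ) * B.map (MvPolynomial.coeff u) =
            (∏ p, ((d p.1 : ℂ) * (e p.2 : ℂ)) ^ (u p)) •
              (B.map (MvPolynomial.coeff u) * (h : Matrix (Fin m) (Fin m) ℂ))) ∧
        LinearMap.ker (Matrix.toLin' (constPart B)) ≤
          Module.End.maxGenEigenspace (Matrix.toLin' (h : Matrix (Fin m) (Fin m) ℂ)) γ₀ ∧
        (constPart B).rank = m - 1 := by
  intro δ n hn m r Λ B hB d e hde
  classical
  obtain ⟨⟨-, hdet⟩, hlift⟩ := hB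
  -- (1) the diagonal torus element as an element of `GL_{n²}` in the generating set
  let γ : GL (Fin n × Fin n) ℂ :=
    ⟨Matrix.diagonal fun p => (d p.1 : ℂ) * (e p.2 : ℂ),
      Matrix.diagonal fun p => (((d p.1 * e p.2)⁻¹ : ℂˣ) : ℂ), by
        rw [Matrix.diagonal_mul_diagonal, ← Matrix.diagonal_one]
        congr 1; funext p
        rw [← Units.val_mul, ← Units.val_mul, mul_inv_cancel, Units.val_one], by
        rw [Matrix.diagonal_mul_diagonal, ← Matrix.diagonal_one]
        congr 1; funext p
        rw [← Units.val_mul, ← Units.val_mul, inv_mul_cancel, Units.val_one]⟩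
  have hγ : (γ : Matrix (Fin n × Fin n) (Fin n × Fin n) ℂ) = Matrix.diagonal fun p => (d p.1 : ℂ) * (e p.2 : ℂ) :=
    rfl
  obtain ⟨g, h, hgh⟩ := hlift γ (Subgroup.subset_closure ⟨d, e, hde, hγ⟩)
  have hhinv : ((h⁻¹ : GL (Fin m) ℂ) : Matrix (Fin m) (Fin m) ℂ) * (h : Matrix (Fin m) (Fin m) ℂ) = 1 := by
    rw [← Units.val_mul, inv_mul_cancel, Units.val_one]
  -- (2) monomial-wise intertwining
  have hu : ∀ u : (Fin n × Fin n) →₀ ℕ,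
      (g : Matrix (Fin m) (Fin m) ℂ) * B.map (MvPolynomial.coeff u) =
        (∏ p, ((d p.1 : ℂ) * (e p.2 : ℂ)) ^ (u p)) •
          (B.map (MvPolynomial.coeff u) * (h : Matrix (Fin m) (Fin m) ℂ)) := by
    intro u
    have e1 := congrArg (fun M : Matrix (Fin m) (Fin m) (MvPolynomial (Fin n × Fin n) ℂ) => M.map (coeff u)) hgh
    rw [map_coeff_linSubstEntries_diagonal γ _ hγ, map_coeff_C_mul_mul_C] at e1
    -- `e1 : (de)^u • B_u = g B_u h⁻¹`
    calc (g : Matrix (Fin m) (Fin m) ℂ) * B.map (coeff u)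
        = (g : Matrix (Fin m) (Fin m) ℂ) * B.map (coeff u) *
            (((h⁻¹ : GL (Fin m) ℂ) : Matrix (Fin m) (Fin m) ℂ) * (h : Matrix (Fin m) (Fin m) ℂ)) := by
          rw [hhinv, Matrix.mul_one]
      _ = ((∏ p, ((d p.1 : ℂ) * (e p.2 : ℂ)) ^ (u p)) • B.map (coeff u)) * (h : Matrix (Fin m) (Fin m) ℂ) := by
          rw [← Matrix.mul_assoc, ← e1]
      _ = (∏ p, ((d p.1 : ℂ) * (e p.2 : ℂ)) ^ (u p)) • (B.map (coeff u) * (h : Matrix (Fin m) (Fin m) ℂ)) := by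
          rw [Matrix.smul_mul]
  -- (3) regularity (von zur Gathen) and the kernel line
  have hrank : (constPart B).rank = m - 1 := rank_constPart_eq hn hdet
  have hm0 : 0 < m := pos_of_det_eq_perPoly (by omega) hdet
  have hK : Module.finrank ℂ (LinearMap.ker (Matrix.toLin' (constPart B))) = 1 :=
    finrank_ker_toLin'_eq_one hm0 hrank
  have h0 : (g : Matrix (Fin m) (Fin m) ℂ) * constPart B = constPart B * (h : Matrix (Fin m) (Fin m) ℂ) :=
    mul_constPart_eq_of_linSubstEntries_eq hgh
  -- `h` as a linear automorphism preserving `ker B₀`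
  let Ch : (Fin m → ℂ) ≃ₗ[ℂ] (Fin m → ℂ) :=
    LinearEquiv.ofLinear (Matrix.toLin' (h : Matrix (Fin m) (Fin m) ℂ))
      (Matrix.toLin' ((h⁻¹ : GL (Fin m) ℂ) : Matrix (Fin m) (Fin m) ℂ))
      (by rw [← Matrix.toLin'_mul, ← Units.val_mul, mul_inv_cancel, Units.val_one, Matrix.toLin'_one])
      (by rw [← Matrix.toLin'_mul, hhinv, Matrix.toLin'_one])
  have hCle : (LinearMap.ker (Matrix.toLin' (constPart B))).map (Ch : (Fin m → ℂ) →ₗ[ℂ] (Fin m → ℂ)) ≤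
      LinearMap.ker (Matrix.toLin' (constPart B)) := by
    rintro _ ⟨v, hv, rfl⟩
    simp only [SetLike.mem_coe, LinearMap.mem_ker] at hv ⊢
    change Matrix.toLin' (constPart B) (Matrix.toLin' (h : Matrix (Fin m) (Fin m) ℂ) v) = 0
    rw [← Matrix.toLin'_mul_apply, ← h0, Matrix.toLin'_mul_apply, hv, map_zero]
  have hC : (LinearMap.ker (Matrix.toLin' (constPart B))).map (Ch : (Fin m → ℂ) →ₗ[ℂ] (Fin m → ℂ)) =
      LinearMap.ker (Matrix.toLin' (constPart B)) :=
    Submodule.eq_of_le_of_finrank_eq hCle (LinearEquiv.finrank_map_eq Ch _)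
  obtain ⟨γ₀, hγ₀, hker⟩ := exists_eigenvalue_of_finrank_ker_eq_one (Matrix.toLin' (constPart B)) Ch hC hK
  exact ⟨g, h, γ₀, hγ₀, hu, hker, hrank⟩

end Summit.ValiantsHypothesis.ValiantsHypothesis.Theorems.FreeSubtorusOrbitDimensionBound

end
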